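import Summits.HodgeConjecture.CorCM.HypLiu418.A3Liu418GSFrobenius
import Summits.HodgeConjecture.CorCM.B01.Transposition.Item6OmegaChiSplitting
import Literature.NumberTheory.Automorphic.Liu2021.Def411WeilCarriersAtLine
import Summits.HodgeConjecture.CorCM.D2Bridge.AdapterMuConj
import HarnessLib

/-!
# [Liu2021, Thm. D.6 (1)] for ONE unitary Shimura curve (named fact `thmD6OneCurveCUF`) and the decomposition package of the GS face
# (`DecompositionAtFace`, `DecompositionAtFaceAdapted`) through which it implies GS-6 `frobeniusActsByGS`

GS-6 (`A3Liu418GSFrobenius.frobeniusActsByGS`, [Liu2021, proof of Thm. 4.15 l. 2199–2212 + App. D Thm. D.6 (1) + Rem. D.5]) says: the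
arithmetic Frobenii act on the `ω(ν,ε,χ)|_{U(J⋆)}`-Hom-space of `ℚ_ℓ^{ac} ⊗ H¹_ét` of the GS unitary Shimura CURVE tower by
`(ι′ μ^{alg}(ϖ_v))⁻¹`.  In print this is Thm. D.6 (1) for the curve `Sh(U(J⋆))` ALONE, applied after decomposing the restriction
`ω(ν,ε,χ)|_{U(V⋆)} = ⊕_i ω⋆(ν,ε_i,χ_i) ⊗ M_i` along `V = V⋆ ⊕ V⋆^⊥` (l. 2193–2212, Rem. D.5).  This file holds the TEXTS of that reduction:

* §1 the rank-2 χ-splitting twin `sChiGS` / `hsChiGS` / `hscChiGS` of the curve datum `(diag dJ, J_W a)`;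
* §2 **`thmD6OneCurveCUF : Prop`** — [Liu2021, Thm. D.6 (1)] for `Sh(U(J⋆))` alone, in GS-6's currency (NAMED FACT, D-0014; see its docstring
  for the print, the dictionary, uniformity of the exceptional set, and the junk analysis);
* §3 **`DecompositionAtFace : Prop`** — the ∃-package at the face (frame data at `a′⁻¹` with the signature clause, curve Weil data,
  jointly injective Galois-commuting `H¹`-projectors `P i`, `ν`-admissible labels, multiplicity modules `M i`, `q i : ω(ν,ε,χ) → ω⋆_i ⊗ M i`,
  and the factorisation `P i ∘ f′ = g ∘ q i` of every `f′` in the face Hom-space through a `g` whose slices lie in the curve Hom-spaces);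
* §4 **`UVat`** — the face model `muConj (uniformOmegaRep …)` at an ARBITRARY frame `(dV, ιV)` (`UV = UVat (frameD V) … (ιVE V)` by `rfl`)
  and **`DecompositionAtFaceAdapted : Prop`** — the package with the face carriers read at `UVat dV … ιV` for SOME frame plus a
  `𝔾(𝔸_F^∞)`-equivariant `ℂ`-linear transport `Ψ` (the face model `UV` sits at the FIXED rational frame of `V`, which is not adapted to
  the splitting `ᵗ(cB)(a′H_V)B = J⋆ ⊕ J⊥`; the decomposition is produced at the adapted frame `D′ = B·(g⋆ ⊕ 1)` and transported).

The heads (`frobeniusActsByGS` from `thmD6OneCurveCUF` and the package; the transfer `DecompositionAtFaceAdapted → DecompositionAtFace`;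
the degenerate sign branch) are in `A3Liu418GSFrobeniusOfThmD6.lean`.  Nothing here is a proof of GS-6.

## References
* [Liu2021] Y. Liu, *Fourier–Jacobi cycles and arithmetic relative trace formula* (FJcycle.tex), Camb. J. Math. 9 (2021) = arXiv:2102.11518:
  Thm. 4.15 proof p. 51 (l. 2193–2212); Def. 4.11 (l. 2083–2097), Def. 4.12, Rem. 4.4; App. D: Prop. D.4 (1) p. 130, Rem. D.5 p. 131,
  Thm. D.6 (1) p. 132 (l. 5433–5443), §D.3 (l. 5353–5359), §D.4 pp. 139–140.
* [GelbartRogawski1991] S. Gelbart, J. Rogawski, Invent. Math. 105 (1991), §3.1 Prop. 3.1.1 p. 455. -/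

noncomputable section

open scoped TensorProduct Matrix NumberField Kronecker ComplexOrder
open NumberField NumberField.InfinitePlace IsDedekindDomain
open Summit.HodgeConjecture.CorCM.Model Summit.HodgeConjecture.CorCM.Model.HComp Summit.HodgeConjecture.CorCM.HComp
open Literature.AlgebraicGeometry.Motives (CMType)
open Literature.AlgebraicGeometry.ShimuraVarieties.UnitaryCanonicalModel
open Literature.NumberTheory.Automorphic Literature.NumberTheory.Automorphic.UnitaryGroup
open Literature.NumberTheory.Automorphic.IdeleClassGroup Literature.NumberTheory.Automorphic.Liu2021 Literature.NumberTheory.Automorphic.Liu2021.AppendixC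
open Literature.NumberTheory.GaloisRepresentations Literature.RepresentationTheory.Liu2021 Literature.RepresentationTheory.HarrisKudlaSweet1996
open Literature.AlgebraicGeometry.Liu2021 (IsAdmissibleElement)
open Literature.NumberTheory.Weil1964 Literature.NumberTheory.GelbartRogawski1991 Literature.NumberTheory.GelbartRogawski1991.UnitaryDualPair Literature.NumberTheory.GelbartRogawski1991.UnitaryDualPair.WeilCoinv
open Literature.NumberTheory.GelbartRogawski1991.UnitaryDualPair.LocalSplitting
open Literature.NumberTheory.Automorphic.Liu2021.Def411WeilCarriersDoubling
open Literature.NumberTheory.Automorphic.Liu2021.Def411WeilCarriers (TW JW JW_eq isSymm_TW isUnit_det_TW Rep Eps epsOf Chi rhoVAtLine)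

namespace Summit.HodgeConjecture.CorCM.Lines.A3Liu418

/-! ## §1 The rank-2 χ-splitting twin of the curve datum -/

section Twin

variable (F : CMField) {n : ℕ} (e : Fin 2 × Fin 1 ≃ Fin n) (dJ : Fin 2 → F)
  (hdJ : ∀ i, IsCMField.complexConj F (dJ i) = dJ i) (hdJ0 : ∀ i, dJ i ≠ 0)
  (χ : HeckeCharacter F) (hχu : χ.IsUnitary) (hχs : IsSplittingChar F 1 χ)

/-- the splitting ATTACHED TO `χ` of `U(diag dJ)(𝔸) × U(J_W a)(𝔸)` (rank-2 twin of ★ `sChiD`). [cite: GelbartRogawski1991, §3.1 Prop. 3.1.1 p. 455] -/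
def sChiGS (a : (↥(maximalRealSubfield F))ˣ) :
    UnitaryGroup.adelicPair ↥(maximalRealSubfield F) F (IsCMField.complexConj F) 2 1 (Matrix.diagonal dJ)
        (JW ↥(maximalRealSubfield F) F a) →*
      adelicMpCont ↥(maximalRealSubfield F) (Fin n)
        (adelicGram ↥(maximalRealSubfield F) e (realDiagonal F dJ hdJ) (TW ↥(maximalRealSubfield F) a)) :=
  chiSplittingLine F e dJ hdJ hdJ0 χ hχu hχs (TW ↥(maximalRealSubfield F) a) (isUnit_det_TW ↥(maximalRealSubfield F) a)
    (JW ↥(maximalRealSubfield F) F a) (JW_eq ↥(maximalRealSubfield F) F a)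

/-- `sChiGS` is a compatible splitting of the line datum (rank-2 twin of ★ `hsChiD`). [cite: GelbartRogawski1991, §3.1 Prop. 3.1.1 p. 455] -/
theorem hsChiGS (a : (↥(maximalRealSubfield F))ˣ) :
    (splittingDatum ↥(maximalRealSubfield F) F (IsCMField.complexConj F) 2 1 e (Matrix.diagonal dJ)
        (JW ↥(maximalRealSubfield F) F a) (complexConj_imagUnit F) (imagUnit_ne_zero F) (imagUnit_mul_self F)
        (realDiagonal_isSymm F dJ hdJ) (isSymm_TW ↥(maximalRealSubfield F) a) (isUnit_det_realDiagonal F dJ hdJ hdJ0)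
        (isUnit_det_TW ↥(maximalRealSubfield F) a) (realDiagonal_map F dJ hdJ).symm
        (JW_eq ↥(maximalRealSubfield F) F a)).IsCompatible
      (sChiGS F e dJ hdJ hdJ0 χ hχu hχs a) :=
  isCompatible_chiSplittingLine F e dJ hdJ hdJ0 χ hχu hχs (TW ↥(maximalRealSubfield F) a)
    (isSymm_TW ↥(maximalRealSubfield F) a) (isUnit_det_TW ↥(maximalRealSubfield F) a) (JW ↥(maximalRealSubfield F) F a)
    (JW_eq ↥(maximalRealSubfield F) F a)

/-- the pair splitting of `sChiGS` is continuous (rank-2 twin of ★ `hscChiD`). [cite: GelbartRogawski1991, §3.1 Prop. 3.1.1 p. 455] -/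
theorem hscChiGS (a : (↥(maximalRealSubfield F))ˣ) :
    Continuous (pairSplitting ↥(maximalRealSubfield F) F (IsCMField.complexConj F) 2 1 e (Matrix.diagonal dJ)
      (JW ↥(maximalRealSubfield F) F a) (sChiGS F e dJ hdJ hdJ0 χ hχu hχs a)) :=
  continuous_pairSplitting_chiSplittingLine F e dJ hdJ hdJ0 χ hχu hχs (TW ↥(maximalRealSubfield F) a)
    (isUnit_det_TW ↥(maximalRealSubfield F) a) (JW ↥(maximalRealSubfield F) F a) (JW_eq ↥(maximalRealSubfield F) F a)

end Twin

/-! ## §2 The named fact: [Liu2021, Thm. D.6 (1)] for one unitary Shimura curve -/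

/-- **`thmD6OneCurveCUF` — [Liu2021, Thm. D.6 (1)] for the unitary Shimura CURVE `Sh(U(J⋆))` ALONE** (NAMED FACT, D-0014: the
printed theorem, not proved here).
PRINT. [Liu2021] App. D, `G = Res_{F/ℚ} U(V)` with `V` of RANK 2, signature `(1,1)` at `τ₁` and `(2,0)` elsewhere (l. 5355);
`ρ_{ι_ℓ}(π^∞) := Hom_{ℚ̄_ℓ[G(𝔸^∞)]}(ι_ℓ ∘ π^∞, H¹_ét(Sh(G,h)^‾, ℚ̄_ℓ))` (l. 5418–5426), a CHARACTER of `Gal(ℂ/E)` by Prop. D.4 (1) p. 130;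
**Thm. D.6 (1)** p. 132 (l. 5436–5443): «Suppose that `π^∞` is endoscopic cohomological, which is isomorphic to `ω(μ,ε,χ)` with `μ` of
weight one and satisfying `τ′₁ ∈ Φ_μ` as in Prop. D.4 (1). Then `ρ_ℓ(π^∞) = μ·|·|_E^{−1/2}` if `m_cusp(π_∞^{(1,0)} ⊗ π^∞) = 1`;
`μ^c χ̌·|·|_E^{−1/2}` if `m_cusp(π_∞^{(0,1)} ⊗ π^∞) = 1`»; the BRANCH by **Rem. D.5** p. 131 (l. 5396–5405): `m_cusp(π_∞^{(1,0)} ⊗ π^∞) = 1`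
iff `ε` is `μ`-ADMISSIBLE (`∃ e ∈ E^{×−}` with `ε_v = e·Nm E_v^×` at every finite `v` and the printed sign conditions; Def. 4.12 p. 47, the
tree's `IsAdmissibleElement`); proof §D.4 pp. 139–140 (Prop. D.8, Cor. D.9).
TYPED, in GS-6's (`muConj`) currency: for every CM field `F` (Galois over `ℚ`), conjugate-symplectic `μ` of weight one, prime `ℓ`,
`ι′ : ℂ ≃ ℚ_ℓ^{ac}`, every hermitian `J⋆` of rank 2 WITH a scalar `t` (`0 < ι₁ t` real: `_hτt`, `_hτt′`) and a rational frame `g⋆`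
taking `t • J⋆` to a REAL DIAGONAL `diag dJ` of signature `(1,1)` at `ι₁` and definite elsewhere (`_hsig` = l. 5355 verbatim; the frame
lives on the Weil side, the record over `J⋆` itself), every curve record `S : RecordSystemGS F J⋆ ι₁ K₀` with Hecke translates over `F`
and printed level quotients, and curve Weil datum `r` (normaliser pinned to `(2i)⁻¹`): THERE IS a finite set `Sv` of places such that for every `ε` that is
`μ`-admissible with the CONJUGATE normaliser PINNED to `δ = (2i)⁻¹` (`∃ e, IsAdmissibleElement F Φ_μ e ∧ epsOf (2i)⁻¹ (−e) = ε`; a free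
normaliser `δ′` would admit print-false labels on other `F⁺`-slices, Rem. D.5) and every `χ`, every arithmetic
Frobenius `σ` at `𝔓 ∣ v ∉ Sv` acts on the values of every
`f′ ∈ Hom_{U(J⋆)(𝔸_f)}(ι′ ∘ (ω⋆(μᶜ-splitting, r ε, χ) ∘ (finAdelicCongr g⋆)⁻¹), ℚ̄_ℓ ⊗ H¹_ét)` (the curve's `etaleHeckeDatumGS`,
`omegaHom`; `ω⋆ = rhoVAtLine … 2 … (diag dJ) … (hsChiGS … (galConj μ) …)`) by `(ι′ (μ^{alg}.valueAtUniformizer v))⁻¹` — the tree's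
normalisation: ARITHMETIC Frobenius, INVERSE uniformiser value, as `S34SomeSource` / GS-6.
DICTIONARY (= GS-6's, `μ` here = GS-6's `ν`): the tree's `μ` with `hμ : IsConjugateSymplectic`, CM type `hμ.cmType`, splitting family at
`galConj μ` and normaliser `epsOf (2i)⁻¹ (−e)` is PRINT's label `μ` of D.6 (1) with `τ′₁ ∈ Φ_μ` — the `muConj` relabelling `ν ↦ νᶜ` of
`AdapterMuConj` ([Liu2021, Rem. 4.4; Def. 4.12 l. 2109]); a print reader applies D.6 (1) to THAT label and gets eigenvalue `μ`, which is
what the conclusion states.  For `n = 2` the two labels of `ω⋆` are ambiguous (Lemma D.1 (4)): `ε′ ≠ ε` exactly on the anisotropic set,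
and the eigenvalue is the label's own `μ` either way, so no `τ′₁ ∈ Φ_μ` binder is carried.  UNIFORMITY: `Sv` is chosen BEFORE `(ε, χ)`
— stronger than GS-6's per-`(ε, χ)` clause, and ≤ print because `ρ_ℓ(π^∞) = μ|·|^{−1/2}` is an identity of automorphic characters, so
`Sv = {v ∣ ℓ} ∪ cond(μ)` serves every label.  JUNK: a record `S : RecordSystemGS F J⋆ ι₁ K₀` cannot carry a non-canonical model (its
reciprocity law `S.recip` at the special points together with `S.pts` pins the canonical model), its `towerRep` is the real `H¹_ét` of
the Albanese varieties and the Hecke side is induced by the record's translates; the anti-oriented frame `ι₁ t < 0` (complex-conjugate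
datum, branch `(0,1)`) is excluded by `_hτt` / `_hτt′`.
[cite: Liu2021, Thm. D.6 (1) p. 132 (l. 5433–5443); Prop. D.4 (1) p. 130; Rem. D.5 p. 131 (l. 5396–5405); §D.3 l. 5353–5359; §D.4 proof pp. 139–140; Thm. 4.15 proof p. 51 (l. 2199–2212)] -/
def thmD6OneCurveCUF : Prop :=
  ∀ (F : CMField) [IsGalois ℚ F] {ι₁ : F →+* ℂ}
    (μ : Literature.NumberTheory.Automorphic.IdeleClassGroup (F : Type) →ₜ* Circle)
    (hμ : IdeleClassGroup.IsConjugateSymplectic (F : Type) μ)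
    (_hw : IdeleClassGroup.HasWeight (F : Type) μ 1)
    -- NO `ι₁ ∈ Φ_μ` binder: GS-6 relates `ι₁` to no CM type of `ν` (its free `(Φ, _hΦ)` only feeds `UV`)
    (ℓ : ℕ) [Fact ℓ.Prime] (ι' : ℂ ≃+* AlgebraicClosure ℚ_[ℓ])
    -- the curve: ANY rank-2 hermitian Gram matrix `J⋆`, WITH a positive real scalar `t` and a rational frame `g⋆` taking `t • J⋆` to the
    -- REAL DIAGONAL `diag dJ` of signature (1,1) at `ι₁` and definite elsewhere (the frame lives on the Weil side);
    -- its record (over `J⋆` itself); §4.2 tokens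
    (Jstar : Matrix (Fin 2) (Fin 2) (F : Type)) (t : (F : Type)) (ht : t ≠ 0) (_hτt : 0 < (ι₁ t).re) (_hτt' : (ι₁ t).im = 0)
    (gstar : GL (Fin 2) (F : Type))
    (dJ : Fin 2 → (F : Type)) (hdJ : ∀ i, IsCMField.complexConj (F : Type) (dJ i) = dJ i) (hdJ0 : ∀ i, dJ i ≠ 0)
    (hg : formCongr ((IsCMField.complexConj (F : Type) : (F : Type) ≃ₐ[↥(maximalRealSubfield (F : Type))] (F : Type)) :
        (F : Type) →+* (F : Type)) gstar (t • Jstar) = Matrix.diagonal dJ)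
    (_hsig : (∃ Tstar : GL (Fin 2) ℂ,
        formCongr (starRingEnd ℂ) Tstar ((Matrix.diagonal dJ).map ι₁) = Matrix.diagonal ![(1 : ℂ), -1]) ∧
      ∀ τ' : (F : Type) →+* ℂ, InfinitePlace.mk τ' ≠ InfinitePlace.mk ι₁ → ((Matrix.diagonal dJ).map τ').PosDef)
    (K₀ : C5.OpenCompactSubgroup ↥(finAdelic ↥(maximalRealSubfield (F : Type)) (F : Type) (IsCMField.complexConj (F : Type)) 2 Jstar))
    (S : RecordSystemGS (F : Type) Jstar ι₁ K₀) (hU7ₛ : S.HeckeTranslateDefinedOver) (hLQ : S.IsLevelQuotient)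
    (h4 : 4 ≤ Module.finrank ℚ (F : Type)) (isoₛ : ℕ → Prop)
    -- the Weil side at the curve ALONE: generic currency at `N := 2`, `JV := diagonal dJ`, splitting family attached to `μᶜ` (GS-6 currency)
    (r : Rep ↥(maximalRealSubfield (F : Type)) (imagUnitSq F)),
    -- the exceptional set is chosen BEFORE `(ε, χ)`: uniform over the blocks of one face carrier (the assembly consumes it; stronger than
    -- GS-6's per-`(ε, χ)` `Sv`, ≤ print by the character identity)
    ∃ Sv : Set (HeightOneSpectrum (𝓞 (F : Type))), Sv.Finite ∧
    ∀ (ε : Eps ↥(maximalRealSubfield (F : Type)) (imagUnitSq F))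
    (_hadm : ∃ e : (F : Type), IsAdmissibleElement (F : Type) hμ.cmType.1 e ∧
      epsOf ↥(maximalRealSubfield (F : Type)) (imagUnitSq F) (F : Type) (2 * imagUnit (F : Type))⁻¹ (-e) = ε)   -- = `(muConj _).epsOf e`
    (χ : Chi ↥(maximalRealSubfield (F : Type)) (F : Type) (IsCMField.complexConj (F : Type))),
      ∀ v ∉ Sv, ∀ 𝔓 ∈ v.primesAbove, ∀ σ : Field.absoluteGaloisGroup (F : Type), IsArithFrobAt (𝓞 (F : Type)) σ 𝔓 →
        ∀ f' ∈ (etaleHeckeDatumGS S hU7ₛ hLQ h4 isoₛ ℓ).omegaHom ι'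
            ((rhoVAtLine ↥(maximalRealSubfield (F : Type)) (F : Type) (IsCMField.complexConj (F : Type)) 2
              (finProdFinEquiv : Fin 2 × Fin 1 ≃ Fin (2 * 1)) (Matrix.diagonal dJ)
              (complexConj_imagUnit F) (imagUnit_ne_zero F) (imagUnit_mul_self F) (realDiagonal_isSymm F dJ hdJ)
              (isUnit_det_realDiagonal F dJ hdJ hdJ0) (realDiagonal_map F dJ hdJ).symm
              (hsChiGS F finProdFinEquiv dJ hdJ hdJ0   -- splitting family at the CONJUGATE label, as `(muConj 𝕌_V).rho ν = 𝕌_V.rho νᶜ`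
                (toHeckeCharacter (F : Type) (galConj (IsCMField.complexConj (F : Type)) μ))
                (isUnitary_toHeckeCharacter (F : Type) (galConj (IsCMField.complexConj (F : Type)) μ))
                ((isOscillatorChar_toHeckeCharacter_iff (galConj (IsCMField.complexConj (F : Type)) μ)).mpr hμ.galConj))
              (r.toFun ε) χ).comp
              (finAdelicCongr ↥(maximalRealSubfield (F : Type)) (F : Type) (IsCMField.complexConj (F : Type)) gstar ht hg).symm.toMonoidHom),
        ∀ w, ((sec42DataGS S h4 isoₛ).towerRep ℓ σ).baseChange (AlgebraicClosure ℚ_[ℓ]) (f' w) =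
          (ι' ((IdeleClassGroup.muAlg (F : Type) μ).valueAtUniformizer v))⁻¹ • f' w

/-! ## §3 The decomposition package at the face -/

set_option maxHeartbeats 400000 in -- measured (160 k, 200 k]: statement-elaboration cliff just above the B30 margin (A-p01 (g7) O5)
/-- **`DecompositionAtFace` — the ∃-package at the GS face** (one `Prop`; binder prefix = GS-6's through `χ`, then the complement
POSITIVE at `ι₁`): frame data at `a′⁻¹` with the signature clause, curve Weil data, jointly injective Galois-commuting `H¹`-projectors `P i`,
`ν`-admissible labels, multiplicity modules `M i`, `ℂ`-linear `q i : ω(ν,ε,χ) → ω⋆_i ⊗ M i`, and the factorisation `P i ∘ f′ = g ∘ q i` of every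
`f′` in the face Hom-space through a semilinear `g` whose slices lie in the curve Hom-spaces.  A statement, nothing asserted.
[cite: Liu2021, Thm. 4.15 proof l. 2199–2212; Rem. D.5 p. 131; Thm. D.6 (1) p. 132] [cite: GelbartRogawski1991, §3.1 Prop. 3.1.1] -/
def DecompositionAtFace : Prop :=
  ∀ (hDel : Literature.AlgebraicGeometry.ShimuraVarieties.UnitaryCanonicalModel.canonicalModel_exists_printed)
    (F : HodgeCM.CMField) [IsGalois ℚ F] {ι₁ : F →+* ℂ} (V : HodgeCM.HermSpace3 F ι₁) (a : HodgeCM.Model.LiuIndex.RealScalar F) (Φ : CMType F)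
    (_hΦ : ι₁ ∈ Φ.1)
    (ν : Literature.NumberTheory.Automorphic.IdeleClassGroup (F : Type) →ₜ* Circle) (hν : IdeleClassGroup.IsConjugateSymplectic (F : Type) ν)
    (_hw : IdeleClassGroup.HasWeight (F : Type) ν 1)
    (ℓ : ℕ) [Fact ℓ.Prime] (ι' : ℂ ≃+* AlgebraicClosure ℚ_[ℓ])
    -- the GS curve: record (★ GS-2), u1 Hecke translates over `F`, u4 level quotients (★ GS-2b), §4.2 tokens
    (Jstar : Matrix (Fin 2) (Fin 2) (F : Type))
    (K₀ : C5.OpenCompactSubgroup ↥(finAdelic ↥(maximalRealSubfield (F : Type)) (F : Type) (IsCMField.complexConj (F : Type)) 2 Jstar))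
    (S : RecordSystemGS (F : Type) Jstar ι₁ K₀) (hU7ₛ : S.HeckeTranslateDefinedOver) (hLQ : S.IsLevelQuotient)
    (h4 : 4 ≤ Module.finrank ℚ (F : Type)) (isoₛ : ℕ → Prop)
    -- the adapted frame `ᵗ(c B)·(a′ H_V)·B = J⋆ ⊕ J⊥`, `0 < τ₁(a′)`, along which `U(J⋆) ↪ U(V)`, `u ↦ R_B (u ⊕ 1)` (★ `φGS`)
    (Jperp : Matrix (Fin 1) (Fin 1) (F : Type)) (B : GL (Fin 3) (F : Type)) (a' : (F : Type)) (ha : a' ≠ 0)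
    (hB : formCongr ((IsCMField.complexConj (F : Type) : (F : Type) ≃ₐ[↥(maximalRealSubfield (F : Type))] (F : Type)) :
        (F : Type) →+* (F : Type)) B (a' • HodgeCM.HermSpace3.Hm V) = finSum 2 1 Jstar Jperp)
    (_hτa : 0 < (ι₁ a').re) (_hτa' : (ι₁ a').im = 0)
    -- the complement `J⊥` POSITIVE at `ι₁` (the printed case, l. 2193); the other sign is the degenerate branch
    (hpos : 0 < (ι₁ (Jperp 0 0)).re),
    ∀ (ε : (UV hDel F V a Φ).Eps),
      (∃ e : (F : Type), IsAdmissibleElement (F : Type) hν.cmType.1 e ∧ (UV hDel F V a Φ).epsOf e = ε) →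
    ∀ (χ : (UV hDel F V a Φ).Chi),
      -- road B⁺: a rational frame `g⋆` taking `a′⁻¹ • J⋆` to the REAL DIAGONAL `diag dJ`, and the signature clause there
      ∃ (gstar : GL (Fin 2) (F : Type)) (dJ : Fin 2 → (F : Type)) (hdJ : ∀ i, IsCMField.complexConj (F : Type) (dJ i) = dJ i)
        (hdJ0 : ∀ i, dJ i ≠ 0)
        (hg : formCongr ((IsCMField.complexConj (F : Type) : (F : Type) ≃ₐ[↥(maximalRealSubfield (F : Type))] (F : Type)) :
          (F : Type) →+* (F : Type)) gstar (a'⁻¹ • Jstar) = Matrix.diagonal dJ)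
        (_ : (∃ Tstar : GL (Fin 2) ℂ,
            formCongr (starRingEnd ℂ) Tstar ((Matrix.diagonal dJ).map ι₁) = Matrix.diagonal ![(1 : ℂ), -1]) ∧
          ∀ τ' : (F : Type) →+* ℂ, InfinitePlace.mk τ' ≠ InfinitePlace.mk ι₁ → ((Matrix.diagonal dJ).map τ').PosDef)
      -- the curve Weil data
        (r : Def411WeilCarriers.Rep ↥(maximalRealSubfield (F : Type)) (imagUnitSq F))
      -- G2b: the `H¹`-side projectors, jointly injective, commuting with the Galois action
        (I : Type) (P : I → (AlgebraicClosure ℚ_[ℓ] ⊗[ℚ_[ℓ]] (sec42DataGS (F := ⟨HodgeCM.CMField.K F⟩) S h4 isoₛ).etaleH1Tower ℓ) →ₗ[AlgebraicClosure ℚ_[ℓ]] (AlgebraicClosure ℚ_[ℓ] ⊗[ℚ_[ℓ]] (sec42DataGS (F := ⟨HodgeCM.CMField.K F⟩) S h4 isoₛ).etaleH1Tower ℓ))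
        (_ : ∀ x : (AlgebraicClosure ℚ_[ℓ] ⊗[ℚ_[ℓ]] (sec42DataGS (F := ⟨HodgeCM.CMField.K F⟩) S h4 isoₛ).etaleH1Tower ℓ), (∀ i, P i x = 0) → x = 0)
        (_ : ∀ i (σ : Field.absoluteGaloisGroup (F : Type)) (x : (AlgebraicClosure ℚ_[ℓ] ⊗[ℚ_[ℓ]] (sec42DataGS (F := ⟨HodgeCM.CMField.K F⟩) S h4 isoₛ).etaleH1Tower ℓ)),
          P i (((sec42DataGS (F := ⟨HodgeCM.CMField.K F⟩) S h4 isoₛ).towerRep ℓ σ).baseChange (AlgebraicClosure ℚ_[ℓ]) x) =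
            ((sec42DataGS (F := ⟨HodgeCM.CMField.K F⟩) S h4 isoₛ).towerRep ℓ σ).baseChange (AlgebraicClosure ℚ_[ℓ]) (P i x))
      -- the labels (automorphic by G2b), `ν`-admissible with the conjugate normaliser (GS-6 currency)
        (εc : I → Def411WeilCarriers.Eps ↥(maximalRealSubfield (F : Type)) (imagUnitSq F))
        (χc : I → Def411WeilCarriers.Chi ↥(maximalRealSubfield (F : Type)) (F : Type) (IsCMField.complexConj (F : Type)))
        (_ : ∀ i, ∃ e : (F : Type), IsAdmissibleElement (F : Type) hν.cmType.1 e ∧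
          Def411WeilCarriers.epsOf ↥(maximalRealSubfield (F : Type)) (imagUnitSq F) (F : Type) (2 * imagUnit (HodgeCM.CMField.K F))⁻¹ (-e) = εc i)
      -- G1-face / G2a / G2c: multiplicity modules, the `ℂ`-linear maps to the curve carriers, and the factorisation of every `P i ∘ f′`
        (M : I → ModuleCat.{0} ℂ)
        (q : ∀ i, (UV hDel F V a Φ).omega ν hν ε χ →ₗ[ℂ] (Def411WeilCarriers.omegaAtLine ↥(maximalRealSubfield (F : Type)) (F : Type) (IsCMField.complexConj (F : Type)) 2
              (finProdFinEquiv : Fin 2 × Fin 1 ≃ Fin (2 * 1)) (Matrix.diagonal dJ)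
              (complexConj_imagUnit F) (imagUnit_ne_zero F) (imagUnit_mul_self F) (realDiagonal_isSymm F dJ hdJ)
              (isUnit_det_realDiagonal F dJ hdJ hdJ0) (realDiagonal_map F dJ hdJ).symm
              (hsChiGS ⟨HodgeCM.CMField.K F⟩ finProdFinEquiv dJ hdJ hdJ0
                (toHeckeCharacter (F : Type) (galConj (IsCMField.complexConj (F : Type)) ν))
                (isUnitary_toHeckeCharacter (F : Type) (galConj (IsCMField.complexConj (F : Type)) ν))
                ((isOscillatorChar_toHeckeCharacter_iff (galConj (IsCMField.complexConj (F : Type)) ν)).mpr hν.galConj))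
              (r.toFun (εc i)) (χc i)) ⊗[ℂ] M i),
        ∀ i, ∀ f' ∈ (etaleHeckeDatumGS (F := ⟨HodgeCM.CMField.K F⟩) S hU7ₛ hLQ h4 isoₛ ℓ).omegaHom ι'
            (((UV hDel F V a Φ).rho ν hν ε χ).comp (φGS (F : Type) Jstar Jperp (HodgeCM.HermSpace3.Hm V) B ha hB)),
          ∃ g : (Def411WeilCarriers.omegaAtLine ↥(maximalRealSubfield (F : Type)) (F : Type) (IsCMField.complexConj (F : Type)) 2
              (finProdFinEquiv : Fin 2 × Fin 1 ≃ Fin (2 * 1)) (Matrix.diagonal dJ)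
              (complexConj_imagUnit F) (imagUnit_ne_zero F) (imagUnit_mul_self F) (realDiagonal_isSymm F dJ hdJ)
              (isUnit_det_realDiagonal F dJ hdJ hdJ0) (realDiagonal_map F dJ hdJ).symm
              (hsChiGS ⟨HodgeCM.CMField.K F⟩ finProdFinEquiv dJ hdJ hdJ0
                (toHeckeCharacter (F : Type) (galConj (IsCMField.complexConj (F : Type)) ν))
                (isUnitary_toHeckeCharacter (F : Type) (galConj (IsCMField.complexConj (F : Type)) ν))
                ((isOscillatorChar_toHeckeCharacter_iff (galConj (IsCMField.complexConj (F : Type)) ν)).mpr hν.galConj))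
              (r.toFun (εc i)) (χc i)) ⊗[ℂ] M i →ₛₗ[(ι' : ℂ →+* AlgebraicClosure ℚ_[ℓ])] (AlgebraicClosure ℚ_[ℓ] ⊗[ℚ_[ℓ]] (sec42DataGS (F := ⟨HodgeCM.CMField.K F⟩) S h4 isoₛ).etaleH1Tower ℓ),
            (∀ w, P i (f' w) = g (q i w)) ∧
            ∀ m : M i, g.comp ((TensorProduct.mk ℂ (Def411WeilCarriers.omegaAtLine ↥(maximalRealSubfield (F : Type)) (F : Type) (IsCMField.complexConj (F : Type)) 2
              (finProdFinEquiv : Fin 2 × Fin 1 ≃ Fin (2 * 1)) (Matrix.diagonal dJ)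
              (complexConj_imagUnit F) (imagUnit_ne_zero F) (imagUnit_mul_self F) (realDiagonal_isSymm F dJ hdJ)
              (isUnit_det_realDiagonal F dJ hdJ hdJ0) (realDiagonal_map F dJ hdJ).symm
              (hsChiGS ⟨HodgeCM.CMField.K F⟩ finProdFinEquiv dJ hdJ hdJ0
                (toHeckeCharacter (F : Type) (galConj (IsCMField.complexConj (F : Type)) ν))
                (isUnitary_toHeckeCharacter (F : Type) (galConj (IsCMField.complexConj (F : Type)) ν))
                ((isOscillatorChar_toHeckeCharacter_iff (galConj (IsCMField.complexConj (F : Type)) ν)).mpr hν.galConj))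
              (r.toFun (εc i)) (χc i)) (M i)).flip m) ∈
              (etaleHeckeDatumGS (F := ⟨HodgeCM.CMField.K F⟩) S hU7ₛ hLQ h4 isoₛ ℓ).omegaHom ι'
                ((rhoVAtLine ↥(maximalRealSubfield (F : Type)) (F : Type) (IsCMField.complexConj (F : Type)) 2
              (finProdFinEquiv : Fin 2 × Fin 1 ≃ Fin (2 * 1)) (Matrix.diagonal dJ)
              (complexConj_imagUnit F) (imagUnit_ne_zero F) (imagUnit_mul_self F) (realDiagonal_isSymm F dJ hdJ)
              (isUnit_det_realDiagonal F dJ hdJ hdJ0) (realDiagonal_map F dJ hdJ).symm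
              (hsChiGS ⟨HodgeCM.CMField.K F⟩ finProdFinEquiv dJ hdJ hdJ0
                (toHeckeCharacter (F : Type) (galConj (IsCMField.complexConj (F : Type)) ν))
                (isUnitary_toHeckeCharacter (F : Type) (galConj (IsCMField.complexConj (F : Type)) ν))
                ((isOscillatorChar_toHeckeCharacter_iff (galConj (IsCMField.complexConj (F : Type)) ν)).mpr hν.galConj))
              (r.toFun (εc i)) (χc i)).comp
                  (finAdelicCongr ↥(maximalRealSubfield (F : Type)) (F : Type) (IsCMField.complexConj (F : Type)) gstar
                    (inv_ne_zero ha) hg).symm.toMonoidHom)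

/-! ## §4 The face model at an arbitrary frame and the decomposition package at an adapted frame -/

section Adapted

open HodgeCM.Model HodgeCM.Model.LiuIndex
open Literature.NumberTheory.Automorphic.Liu2021.Def411WeilCarriers (lineOf locF)
open Summit.HodgeConjecture.CorCM.Transposition.OmegaTransport (realUnit)
open HodgeCM.Model.ArchSideTerm (e₁)
open Summit.HodgeConjecture.CorCM.D2Bridge.AdapterMuConj (muConj)

/-- **`𝕌_{V,(dV,ιV)}` — the face model at an ARBITRARY frame**: verbatim the term of `UV` (`A3Liu418Items`:
`muConj (uniformOmegaRep … e₁ (frameD V) … (ιVE V) (2i)⁻¹ r_a)`) with the fixed frame `(frameD V, frameD_real V, frameD_ne V, ιVE V)`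
replaced by `(dV, hdV, hdV0, ιV)`. [cite: Liu2021, Def. 4.11 (l. 2083–2097), Rem. 4.4] -/
abbrev UVat (hDel : Literature.AlgebraicGeometry.ShimuraVarieties.UnitaryCanonicalModel.canonicalModel_exists_printed)
    (F : HodgeCM.CMField) [IsGalois ℚ F] {ι₁ : F →+* ℂ} (V : HodgeCM.HermSpace3 F ι₁) (a : HodgeCM.Model.LiuIndex.RealScalar F) (Φ : CMType F)
    (dV : Fin 3 → (F : Type)) (hdV : ∀ i, IsCMField.complexConj (F : Type) (dV i) = dV i) (hdV0 : ∀ i, dV i ≠ 0)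
    (ιV : (CV hDel F V Φ).G →* finAdelic ↥(maximalRealSubfield (F : Type)) (F : Type) (IsCMField.complexConj (F : Type)) 3 (Matrix.diagonal dV)) :=
  muConj (uniformOmegaRep (Summit.HodgeConjecture.CorCM.DelRec.exists_recordSystem_of_printed hDel) ⟨HodgeCM.CMField.K F⟩ ι₁ ⟨HodgeCM.HermSpace3.Hm V, HodgeCM.HermSpace3.isHermitian V, HodgeCM.HermSpace3.signature_ι₁ V, HodgeCM.HermSpace3.posDef_of_ne V⟩ Φ e₁ dV hdV hdV0 ιV (2 * imagUnit (HodgeCM.CMField.K F))⁻¹ (fun _ _ => (Rep.update ↥(maximalRealSubfield (HodgeCM.CMField.K F)) (imagUnitSq (HodgeCM.CMField.K F)) (Rep.ofLineOf ↥(maximalRealSubfield (HodgeCM.CMField.K F)) (imagUnitSq (HodgeCM.CMField.K F))) (locF ↥(maximalRealSubfield (HodgeCM.CMField.K F)) (imagUnitSq (HodgeCM.CMField.K F)) (realUnit ⟨HodgeCM.CMField.K F⟩ a.1 a.2.1 a.2.2)) (realUnit ⟨HodgeCM.CMField.K F⟩ a.1 a.2.1 a.2.2) rfl)))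

/-- `UV` IS `UVat` at the fixed frame `(frameD V, ιVE V)` (`rfl`). [cite: Liu2021, Def. 4.11] -/
theorem UV_eq_UVat (hDel : Literature.AlgebraicGeometry.ShimuraVarieties.UnitaryCanonicalModel.canonicalModel_exists_printed)
    (F : HodgeCM.CMField) [IsGalois ℚ F] {ι₁ : F →+* ℂ} (V : HodgeCM.HermSpace3 F ι₁) (a : HodgeCM.Model.LiuIndex.RealScalar F) (Φ : CMType F) :
    UV hDel F V a Φ = UVat hDel F V a Φ (frameD V) (frameD_real V) (frameD_ne V) (ιVE V) := rfl

set_option maxHeartbeats 400000 in -- measured (160 k, 200 k]: statement-elaboration cliff just above the B30 margin (A-p01 (g7) O5)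
/-- **`DecompositionAtFaceAdapted` — the ∃-package at an ADAPTED frame**: `DecompositionAtFace` (§3) with, after the signature clause,
four frame binders `(dV, hdV, hdV0, ιV)`, free labels `(ε′, χ′)` of the adapted model, and a `𝔾(𝔸_F^∞)`-equivariant `ℂ`-linear transport
`(Ψ, hΨ)` from the face model `UV` to `UVat … dV hdV hdV0 ιV`, and with the face carriers of `q i` and of the Hom-space of `f′` read at
`UVat … dV hdV hdV0 ιV`.  Binder prefix = GS-6's through `χ` (unchanged).  A statement, nothing asserted.
[cite: Liu2021, Thm. 4.15 proof l. 2199–2212; Rem. D.5 p. 131; Thm. D.6 (1) p. 132] [cite: GelbartRogawski1991, §3.1 Prop. 3.1.1] -/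
def DecompositionAtFaceAdapted : Prop :=
  ∀ (hDel : Literature.AlgebraicGeometry.ShimuraVarieties.UnitaryCanonicalModel.canonicalModel_exists_printed)
    (F : HodgeCM.CMField) [IsGalois ℚ F] {ι₁ : F →+* ℂ} (V : HodgeCM.HermSpace3 F ι₁) (a : HodgeCM.Model.LiuIndex.RealScalar F) (Φ : CMType F)
    (_hΦ : ι₁ ∈ Φ.1)
    (ν : Literature.NumberTheory.Automorphic.IdeleClassGroup (F : Type) →ₜ* Circle) (hν : IdeleClassGroup.IsConjugateSymplectic (F : Type) ν)
    (_hw : IdeleClassGroup.HasWeight (F : Type) ν 1)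
    (ℓ : ℕ) [Fact ℓ.Prime] (ι' : ℂ ≃+* AlgebraicClosure ℚ_[ℓ])
    -- the GS curve: record (★ GS-2), u1 Hecke translates over `F`, u4 level quotients (★ GS-2b), §4.2 tokens
    (Jstar : Matrix (Fin 2) (Fin 2) (F : Type))
    (K₀ : C5.OpenCompactSubgroup ↥(finAdelic ↥(maximalRealSubfield (F : Type)) (F : Type) (IsCMField.complexConj (F : Type)) 2 Jstar))
    (S : RecordSystemGS (F : Type) Jstar ι₁ K₀) (hU7ₛ : S.HeckeTranslateDefinedOver) (hLQ : S.IsLevelQuotient)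
    (h4 : 4 ≤ Module.finrank ℚ (F : Type)) (isoₛ : ℕ → Prop)
    -- the adapted frame `ᵗ(c B)·(a′ H_V)·B = J⋆ ⊕ J⊥`, `0 < τ₁(a′)`, along which `U(J⋆) ↪ U(V)`, `u ↦ R_B (u ⊕ 1)` (★ `φGS`)
    (Jperp : Matrix (Fin 1) (Fin 1) (F : Type)) (B : GL (Fin 3) (F : Type)) (a' : (F : Type)) (ha : a' ≠ 0)
    (hB : formCongr ((IsCMField.complexConj (F : Type) : (F : Type) ≃ₐ[↥(maximalRealSubfield (F : Type))] (F : Type)) :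
        (F : Type) →+* (F : Type)) B (a' • HodgeCM.HermSpace3.Hm V) = finSum 2 1 Jstar Jperp)
    (_hτa : 0 < (ι₁ a').re) (_hτa' : (ι₁ a').im = 0)
    -- the complement `J⊥` POSITIVE at `ι₁` (the printed case, l. 2193); the other sign is the degenerate branch
    (hpos : 0 < (ι₁ (Jperp 0 0)).re),
    ∀ (ε : (UV hDel F V a Φ).Eps),
      (∃ e : (F : Type), IsAdmissibleElement (F : Type) hν.cmType.1 e ∧ (UV hDel F V a Φ).epsOf e = ε) →
    ∀ (χ : (UV hDel F V a Φ).Chi),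
      -- road B⁺: a rational frame `g⋆` taking `a′⁻¹ • J⋆` to the REAL DIAGONAL `diag dJ`, and the signature clause there
      ∃ (gstar : GL (Fin 2) (F : Type)) (dJ : Fin 2 → (F : Type)) (hdJ : ∀ i, IsCMField.complexConj (F : Type) (dJ i) = dJ i)
        (hdJ0 : ∀ i, dJ i ≠ 0)
        (hg : formCongr ((IsCMField.complexConj (F : Type) : (F : Type) ≃ₐ[↥(maximalRealSubfield (F : Type))] (F : Type)) :
          (F : Type) →+* (F : Type)) gstar (a'⁻¹ • Jstar) = Matrix.diagonal dJ)
        (_ : (∃ Tstar : GL (Fin 2) ℂ,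
            formCongr (starRingEnd ℂ) Tstar ((Matrix.diagonal dJ).map ι₁) = Matrix.diagonal ![(1 : ℂ), -1]) ∧
          ∀ τ' : (F : Type) →+* ℂ, InfinitePlace.mk τ' ≠ InfinitePlace.mk ι₁ → ((Matrix.diagonal dJ).map τ').PosDef)
      -- AN ADAPTED FACE FRAME `(dV, ιV)` of `V` (e.g. `dV = dJ ‖ a′⁻¹J⊥₀₀` along `D′ = B·(g⋆ ⊕ 1)`), and a transport
      -- `Ψ : ω_face(ν,ε,χ) ≃ ω_{D′}(ν,ε,χ)` of `𝔾(𝔸_F^∞)`-modules (frame independence of `ω(ν,ε,χ)`)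
        (dV : Fin 3 → (F : Type)) (hdV : ∀ i, IsCMField.complexConj (F : Type) (dV i) = dV i) (hdV0 : ∀ i, dV i ≠ 0)
        (ιV : (CV hDel F V Φ).G →* finAdelic ↥(maximalRealSubfield (F : Type)) (F : Type) (IsCMField.complexConj (F : Type)) 3 (Matrix.diagonal dV))
      -- (labels `(ε′, χ′)` of the adapted model are free: node (T) gives `ε′ = ε`, `χ′ = χ`; stated permissively, and WITHOUT the
      -- `(UV …).Eps = (UVat …).Eps` unification — which is `rfl` but costs > 8M heartbeats at `whnf` when left to the elaborator)
        (ε' : (UVat hDel F V a Φ dV hdV hdV0 ιV).Eps) (χ' : (UVat hDel F V a Φ dV hdV hdV0 ιV).Chi)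
        (Ψ : (UV hDel F V a Φ).omega ν hν ε χ ≃ₗ[ℂ] (UVat hDel F V a Φ dV hdV hdV0 ιV).omega ν hν ε' χ')
        (_ : ∀ (g : (CV hDel F V Φ).G) (x : (UV hDel F V a Φ).omega ν hν ε χ),
          Ψ ((UV hDel F V a Φ).rho ν hν ε χ g x) = (UVat hDel F V a Φ dV hdV hdV0 ιV).rho ν hν ε' χ' g (Ψ x))
      -- the curve Weil data
        (r : Def411WeilCarriers.Rep ↥(maximalRealSubfield (F : Type)) (imagUnitSq F))
      -- G2b: the `H¹`-side projectors, jointly injective, commuting with the Galois action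
        (I : Type) (P : I → (AlgebraicClosure ℚ_[ℓ] ⊗[ℚ_[ℓ]] (sec42DataGS (F := ⟨HodgeCM.CMField.K F⟩) S h4 isoₛ).etaleH1Tower ℓ) →ₗ[AlgebraicClosure ℚ_[ℓ]] (AlgebraicClosure ℚ_[ℓ] ⊗[ℚ_[ℓ]] (sec42DataGS (F := ⟨HodgeCM.CMField.K F⟩) S h4 isoₛ).etaleH1Tower ℓ))
        (_ : ∀ x : (AlgebraicClosure ℚ_[ℓ] ⊗[ℚ_[ℓ]] (sec42DataGS (F := ⟨HodgeCM.CMField.K F⟩) S h4 isoₛ).etaleH1Tower ℓ), (∀ i, P i x = 0) → x = 0)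
        (_ : ∀ i (σ : Field.absoluteGaloisGroup (F : Type)) (x : (AlgebraicClosure ℚ_[ℓ] ⊗[ℚ_[ℓ]] (sec42DataGS (F := ⟨HodgeCM.CMField.K F⟩) S h4 isoₛ).etaleH1Tower ℓ)),
          P i (((sec42DataGS (F := ⟨HodgeCM.CMField.K F⟩) S h4 isoₛ).towerRep ℓ σ).baseChange (AlgebraicClosure ℚ_[ℓ]) x) =
            ((sec42DataGS (F := ⟨HodgeCM.CMField.K F⟩) S h4 isoₛ).towerRep ℓ σ).baseChange (AlgebraicClosure ℚ_[ℓ]) (P i x))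
      -- the labels (automorphic by G2b), `ν`-admissible with the conjugate normaliser (GS-6 currency)
        (εc : I → Def411WeilCarriers.Eps ↥(maximalRealSubfield (F : Type)) (imagUnitSq F))
        (χc : I → Def411WeilCarriers.Chi ↥(maximalRealSubfield (F : Type)) (F : Type) (IsCMField.complexConj (F : Type)))
        (_ : ∀ i, ∃ e : (F : Type), IsAdmissibleElement (F : Type) hν.cmType.1 e ∧
          Def411WeilCarriers.epsOf ↥(maximalRealSubfield (F : Type)) (imagUnitSq F) (F : Type) (2 * imagUnit (HodgeCM.CMField.K F))⁻¹ (-e) = εc i)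
      -- G1-face / G2a / G2c: multiplicity modules, the `ℂ`-linear maps to the curve carriers, and the factorisation of every `P i ∘ f′`
        (M : I → ModuleCat.{0} ℂ)
        (q : ∀ i, (UVat hDel F V a Φ dV hdV hdV0 ιV).omega ν hν ε' χ' →ₗ[ℂ] (Def411WeilCarriers.omegaAtLine ↥(maximalRealSubfield (F : Type)) (F : Type) (IsCMField.complexConj (F : Type)) 2
              (finProdFinEquiv : Fin 2 × Fin 1 ≃ Fin (2 * 1)) (Matrix.diagonal dJ)
              (complexConj_imagUnit F) (imagUnit_ne_zero F) (imagUnit_mul_self F) (realDiagonal_isSymm F dJ hdJ)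
              (isUnit_det_realDiagonal F dJ hdJ hdJ0) (realDiagonal_map F dJ hdJ).symm
              (hsChiGS ⟨HodgeCM.CMField.K F⟩ finProdFinEquiv dJ hdJ hdJ0
                (toHeckeCharacter (F : Type) (galConj (IsCMField.complexConj (F : Type)) ν))
                (isUnitary_toHeckeCharacter (F : Type) (galConj (IsCMField.complexConj (F : Type)) ν))
                ((isOscillatorChar_toHeckeCharacter_iff (galConj (IsCMField.complexConj (F : Type)) ν)).mpr hν.galConj))
              (r.toFun (εc i)) (χc i)) ⊗[ℂ] M i),
        ∀ i, ∀ f' ∈ (etaleHeckeDatumGS (F := ⟨HodgeCM.CMField.K F⟩) S hU7ₛ hLQ h4 isoₛ ℓ).omegaHom ι'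
            (((UVat hDel F V a Φ dV hdV hdV0 ιV).rho ν hν ε' χ').comp (φGS (F : Type) Jstar Jperp (HodgeCM.HermSpace3.Hm V) B ha hB)),
          ∃ g : (Def411WeilCarriers.omegaAtLine ↥(maximalRealSubfield (F : Type)) (F : Type) (IsCMField.complexConj (F : Type)) 2
              (finProdFinEquiv : Fin 2 × Fin 1 ≃ Fin (2 * 1)) (Matrix.diagonal dJ)
              (complexConj_imagUnit F) (imagUnit_ne_zero F) (imagUnit_mul_self F) (realDiagonal_isSymm F dJ hdJ)
              (isUnit_det_realDiagonal F dJ hdJ hdJ0) (realDiagonal_map F dJ hdJ).symm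
              (hsChiGS ⟨HodgeCM.CMField.K F⟩ finProdFinEquiv dJ hdJ hdJ0
                (toHeckeCharacter (F : Type) (galConj (IsCMField.complexConj (F : Type)) ν))
                (isUnitary_toHeckeCharacter (F : Type) (galConj (IsCMField.complexConj (F : Type)) ν))
                ((isOscillatorChar_toHeckeCharacter_iff (galConj (IsCMField.complexConj (F : Type)) ν)).mpr hν.galConj))
              (r.toFun (εc i)) (χc i)) ⊗[ℂ] M i →ₛₗ[(ι' : ℂ →+* AlgebraicClosure ℚ_[ℓ])] (AlgebraicClosure ℚ_[ℓ] ⊗[ℚ_[ℓ]] (sec42DataGS (F := ⟨HodgeCM.CMField.K F⟩) S h4 isoₛ).etaleH1Tower ℓ),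
            (∀ w, P i (f' w) = g (q i w)) ∧
            ∀ m : M i, g.comp ((TensorProduct.mk ℂ (Def411WeilCarriers.omegaAtLine ↥(maximalRealSubfield (F : Type)) (F : Type) (IsCMField.complexConj (F : Type)) 2
              (finProdFinEquiv : Fin 2 × Fin 1 ≃ Fin (2 * 1)) (Matrix.diagonal dJ)
              (complexConj_imagUnit F) (imagUnit_ne_zero F) (imagUnit_mul_self F) (realDiagonal_isSymm F dJ hdJ)
              (isUnit_det_realDiagonal F dJ hdJ hdJ0) (realDiagonal_map F dJ hdJ).symm
              (hsChiGS ⟨HodgeCM.CMField.K F⟩ finProdFinEquiv dJ hdJ hdJ0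
                (toHeckeCharacter (F : Type) (galConj (IsCMField.complexConj (F : Type)) ν))
                (isUnitary_toHeckeCharacter (F : Type) (galConj (IsCMField.complexConj (F : Type)) ν))
                ((isOscillatorChar_toHeckeCharacter_iff (galConj (IsCMField.complexConj (F : Type)) ν)).mpr hν.galConj))
              (r.toFun (εc i)) (χc i)) (M i)).flip m) ∈
              (etaleHeckeDatumGS (F := ⟨HodgeCM.CMField.K F⟩) S hU7ₛ hLQ h4 isoₛ ℓ).omegaHom ι'
                ((rhoVAtLine ↥(maximalRealSubfield (F : Type)) (F : Type) (IsCMField.complexConj (F : Type)) 2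
              (finProdFinEquiv : Fin 2 × Fin 1 ≃ Fin (2 * 1)) (Matrix.diagonal dJ)
              (complexConj_imagUnit F) (imagUnit_ne_zero F) (imagUnit_mul_self F) (realDiagonal_isSymm F dJ hdJ)
              (isUnit_det_realDiagonal F dJ hdJ hdJ0) (realDiagonal_map F dJ hdJ).symm
              (hsChiGS ⟨HodgeCM.CMField.K F⟩ finProdFinEquiv dJ hdJ hdJ0
                (toHeckeCharacter (F : Type) (galConj (IsCMField.complexConj (F : Type)) ν))
                (isUnitary_toHeckeCharacter (F : Type) (galConj (IsCMField.complexConj (F : Type)) ν))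
                ((isOscillatorChar_toHeckeCharacter_iff (galConj (IsCMField.complexConj (F : Type)) ν)).mpr hν.galConj))
              (r.toFun (εc i)) (χc i)).comp
                  (finAdelicCongr ↥(maximalRealSubfield (F : Type)) (F : Type) (IsCMField.complexConj (F : Type)) gstar
                    (inv_ne_zero ha) hg).symm.toMonoidHom)

end Adapted

end Summit.HodgeConjecture.CorCM.Lines.A3Liu418

end
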